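import Mathlib.Analysis.SpecialFunctions.Pow.Real
import HarnessLib

/-!
# QUANT lane R8, Conjecture DIB\* — the TWO-BIG certificate, part 1: the SEGMENT (pinning) lemmas

builds on p205010 (kernel theorem, internal audit signed; external expert review pending)

Support file (`--supports stmt-CriticalPhenomena-4575`), QUANT lane seat prim-quant-p1 (gen 13).  Theorems only (pure real algebra);
no sorries, standard axioms.  Used by `…QuantTwoBigCert*` (the proof of `IndepBlob.TwoBigCert`, `…QuantTwoBig` p276261).

THE REDUCTION STEP THEY SERVE.  After the cloud chains, `TwoBigCert` is `G := T₁q₂ + T₂q₁ + K·q₁q₂ ≤ y` (`K = T₀ − T₁ − T₂`; `T₀, T₁, T₂`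
the explicit level bounds, functions of the cloud credit `c` and the levels only; `qᵢ` the closures of the two conditioned blobs).  Moving the
two defect masses `e₁ ↦ e₁ + t`, `e₂ ↦ e₂ − t` keeps `c` (hence every `T`) fixed and moves `(q₁, q₂)` affinely, `q₁ + s₁t`, `q₂ − s₂t`
(`sᵢ ≥ 0`), inside the current type box.  If `K ≤ 0` the value along the segment is a CONVEX quadratic in `t`; if `K ≥ 0` one first
replaces `q₁q₂` by an affine (McCormick) majorant and the value is AFFINE in `t`.  Either way the value at `t = 0` is at most the larger of
the values at the two ends of the admissible `t`-interval, and at each end one of the two blobs sits at a PIN of its type box (sure /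
kink / dead).  `seg_ex` and `seg_affine` package exactly this: four hypotheses (one per pin event) give the bound at `t = 0`.

* `Quant.IndepBlob.TwoBigSeg.quad_le_max_of_convex` — a convex quadratic on `[lo, hi] ∋ 0` is at most the max of its end values.
* `Quant.IndepBlob.TwoBigSeg.seg_ex` (bilinear value, `K ≤ 0`), `Quant.IndepBlob.TwoBigSeg.seg_affine` (affine value).
[this work]
-/

namespace Summit.CriticalPhenomena.PercolationContinuityZ3.Theorems
namespace Quant
namespace IndepBlob
namespace TwoBigSeg

/-- A convex quadratic `A t² + B t + C` (`A ≥ 0`) on an interval `[lo, hi]` containing `0` is at `0` at most `max` of its end values. [this work] -/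
theorem quad_le_max_of_convex (A B C lo hi : ℝ) (hA : 0 ≤ A) (hlo : lo ≤ 0) (hhi : 0 ≤ hi) :
    C ≤ max (A * lo ^ 2 + B * lo + C) (A * hi ^ 2 + B * hi + C) := by
  by_cases hB : 0 ≤ B
  · refine le_trans ?_ (le_max_right _ _)
    nlinarith [mul_nonneg hA (sq_nonneg hi), mul_nonneg hB hhi]
  · refine le_trans ?_ (le_max_left _ _)
    have hB' : B ≤ 0 := (not_le.1 hB).le
    nlinarith [mul_nonneg hA (sq_nonneg lo), mul_nonneg (neg_nonneg.2 hB') (neg_nonneg.2 hlo)]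

/-- **Segment lemma, bilinear value (`K ≤ 0`).**  Value `V t = T₁(q₂ − s₂t) + T₂(q₁ + s₁t) + K(q₁ + s₁t)(q₂ − s₂t)` with `s₁, s₂ ≥ 0`,
`K ≤ 0`; admissible `t`: `e₁ + t ∈ [a₁, b₁]`, `e₂ − t ∈ [a₂, b₂]` (currently `t = 0` admissible).  If `V t ≤ Y` whenever one of the four
pin events `e₁ + t = a₁`, `e₁ + t = b₁`, `e₂ − t = a₂`, `e₂ − t = b₂` happens (with the other coordinate admissible), then `V 0 ≤ Y`. [this work] -/
theorem seg_ex (T₁ T₂ K q₁ q₂ s₁ s₂ e₁ e₂ a₁ b₁ a₂ b₂ Y : ℝ) (hK : K ≤ 0) (hs₁ : 0 ≤ s₁) (hs₂ : 0 ≤ s₂)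
    (h₁ : a₁ ≤ e₁ ∧ e₁ ≤ b₁) (h₂ : a₂ ≤ e₂ ∧ e₂ ≤ b₂)
    (hA : ∀ t, e₁ + t = a₁ → a₂ ≤ e₂ - t → e₂ - t ≤ b₂ →
      T₁ * (q₂ - s₂ * t) + T₂ * (q₁ + s₁ * t) + K * ((q₁ + s₁ * t) * (q₂ - s₂ * t)) ≤ Y)
    (hB : ∀ t, e₁ + t = b₁ → a₂ ≤ e₂ - t → e₂ - t ≤ b₂ →
      T₁ * (q₂ - s₂ * t) + T₂ * (q₁ + s₁ * t) + K * ((q₁ + s₁ * t) * (q₂ - s₂ * t)) ≤ Y)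
    (hC : ∀ t, e₂ - t = a₂ → a₁ ≤ e₁ + t → e₁ + t ≤ b₁ →
      T₁ * (q₂ - s₂ * t) + T₂ * (q₁ + s₁ * t) + K * ((q₁ + s₁ * t) * (q₂ - s₂ * t)) ≤ Y)
    (hD : ∀ t, e₂ - t = b₂ → a₁ ≤ e₁ + t → e₁ + t ≤ b₁ →
      T₁ * (q₂ - s₂ * t) + T₂ * (q₁ + s₁ * t) + K * ((q₁ + s₁ * t) * (q₂ - s₂ * t)) ≤ Y) :
    T₁ * q₂ + T₂ * q₁ + K * (q₁ * q₂) ≤ Y := by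
  set V : ℝ → ℝ := fun t => T₁ * (q₂ - s₂ * t) + T₂ * (q₁ + s₁ * t) + K * ((q₁ + s₁ * t) * (q₂ - s₂ * t)) with hV
  -- V t = A t² + B t + C with A = −K s₁ s₂ ≥ 0
  have hquad : ∀ t, V t = (-(K * s₁ * s₂)) * t ^ 2 + (T₂ * s₁ - T₁ * s₂ + K * (s₁ * q₂ - s₂ * q₁)) * t
      + (T₁ * q₂ + T₂ * q₁ + K * (q₁ * q₂)) := by
    intro t; simp only [hV]; ring
  have hAc : 0 ≤ -(K * s₁ * s₂) := by nlinarith [mul_nonneg hs₁ hs₂]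
  -- the admissible interval
  set lo : ℝ := max (a₁ - e₁) (e₂ - b₂) with hlo
  set hi : ℝ := min (b₁ - e₁) (e₂ - a₂) with hhi
  have hlo0 : lo ≤ 0 := max_le (by linarith [h₁.1]) (by linarith [h₂.2])
  have hhi0 : 0 ≤ hi := le_min (by linarith [h₁.2]) (by linarith [h₂.1])
  have hVlo : V lo ≤ Y := by
    rcases max_choice (a₁ - e₁) (e₂ - b₂) with h | h
    · have hlo' : lo = a₁ - e₁ := by rw [hlo, h]
      have := hA lo (by rw [hlo']; ring) (by rw [hlo']; nlinarith [le_max_right (a₁ - e₁) (e₂ - b₂), h₂.1, hlo0])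
        (by have := le_max_right (a₁ - e₁) (e₂ - b₂); rw [← hlo] at this; linarith)
      simpa only [hV] using this
    · have hlo' : lo = e₂ - b₂ := by rw [hlo, h]
      have := hD lo (by rw [hlo']; ring) (by have := le_max_left (a₁ - e₁) (e₂ - b₂); rw [← hlo] at this; linarith)
        (by rw [hlo']; linarith [h₁.2, h₂.2, hlo0])
      simpa only [hV] using this
  have hVhi : V hi ≤ Y := by
    rcases min_choice (b₁ - e₁) (e₂ - a₂) with h | h
    · have hhi' : hi = b₁ - e₁ := by rw [hhi, h]
      have := hB hi (by rw [hhi']; ring) (by have := min_le_right (b₁ - e₁) (e₂ - a₂); rw [← hhi] at this; linarith)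
        (by rw [hhi']; linarith [h₂.2, hhi0])
      simpa only [hV] using this
    · have hhi' : hi = e₂ - a₂ := by rw [hhi, h]
      have := hC hi (by rw [hhi']; ring) (by rw [hhi']; linarith [h₁.1, hhi0])
        (by have := min_le_left (b₁ - e₁) (e₂ - a₂); rw [← hhi] at this; linarith)
      simpa only [hV] using this
  have key := quad_le_max_of_convex (-(K * s₁ * s₂)) (T₂ * s₁ - T₁ * s₂ + K * (s₁ * q₂ - s₂ * q₁))
    (T₁ * q₂ + T₂ * q₁ + K * (q₁ * q₂)) lo hi hAc hlo0 hhi0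
  rw [← hquad lo, ← hquad hi] at key
  exact key.trans (max_le hVlo hVhi)

/-- **Segment lemma, affine value.**  Value `V t = T₁(q₂ − s₂t) + T₂(q₁ + s₁t) + K(β₀ + β₁(q₁ + s₁t) + β₂(q₂ − s₂t))` (any signs);
admissible `t` as in `seg_ex`.  If `V t ≤ Y` at the four pin events then `V 0 ≤ Y`. [this work] -/
theorem seg_affine (T₁ T₂ K q₁ q₂ s₁ s₂ β₀ β₁ β₂ e₁ e₂ a₁ b₁ a₂ b₂ Y : ℝ)
    (h₁ : a₁ ≤ e₁ ∧ e₁ ≤ b₁) (h₂ : a₂ ≤ e₂ ∧ e₂ ≤ b₂)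
    (hA : ∀ t, e₁ + t = a₁ → a₂ ≤ e₂ - t → e₂ - t ≤ b₂ →
      T₁ * (q₂ - s₂ * t) + T₂ * (q₁ + s₁ * t) + K * (β₀ + β₁ * (q₁ + s₁ * t) + β₂ * (q₂ - s₂ * t)) ≤ Y)
    (hB : ∀ t, e₁ + t = b₁ → a₂ ≤ e₂ - t → e₂ - t ≤ b₂ →
      T₁ * (q₂ - s₂ * t) + T₂ * (q₁ + s₁ * t) + K * (β₀ + β₁ * (q₁ + s₁ * t) + β₂ * (q₂ - s₂ * t)) ≤ Y)
    (hC : ∀ t, e₂ - t = a₂ → a₁ ≤ e₁ + t → e₁ + t ≤ b₁ →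
      T₁ * (q₂ - s₂ * t) + T₂ * (q₁ + s₁ * t) + K * (β₀ + β₁ * (q₁ + s₁ * t) + β₂ * (q₂ - s₂ * t)) ≤ Y)
    (hD : ∀ t, e₂ - t = b₂ → a₁ ≤ e₁ + t → e₁ + t ≤ b₁ →
      T₁ * (q₂ - s₂ * t) + T₂ * (q₁ + s₁ * t) + K * (β₀ + β₁ * (q₁ + s₁ * t) + β₂ * (q₂ - s₂ * t)) ≤ Y) :
    T₁ * q₂ + T₂ * q₁ + K * (β₀ + β₁ * q₁ + β₂ * q₂) ≤ Y := by
  set V : ℝ → ℝ := fun t => T₁ * (q₂ - s₂ * t) + T₂ * (q₁ + s₁ * t) + K * (β₀ + β₁ * (q₁ + s₁ * t) + β₂ * (q₂ - s₂ * t)) with hV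
  have hquad : ∀ t, V t = (0 : ℝ) * t ^ 2 + (T₂ * s₁ - T₁ * s₂ + K * (β₁ * s₁ - β₂ * s₂)) * t
      + (T₁ * q₂ + T₂ * q₁ + K * (β₀ + β₁ * q₁ + β₂ * q₂)) := by
    intro t; simp only [hV]; ring
  set lo : ℝ := max (a₁ - e₁) (e₂ - b₂) with hlo
  set hi : ℝ := min (b₁ - e₁) (e₂ - a₂) with hhi
  have hlo0 : lo ≤ 0 := max_le (by linarith [h₁.1]) (by linarith [h₂.2])
  have hhi0 : 0 ≤ hi := le_min (by linarith [h₁.2]) (by linarith [h₂.1])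
  have hVlo : V lo ≤ Y := by
    rcases max_choice (a₁ - e₁) (e₂ - b₂) with h | h
    · have hlo' : lo = a₁ - e₁ := by rw [hlo, h]
      have := hA lo (by rw [hlo']; ring) (by rw [hlo']; nlinarith [le_max_right (a₁ - e₁) (e₂ - b₂), h₂.1, hlo0])
        (by have := le_max_right (a₁ - e₁) (e₂ - b₂); rw [← hlo] at this; linarith)
      simpa only [hV] using this
    · have hlo' : lo = e₂ - b₂ := by rw [hlo, h]
      have := hD lo (by rw [hlo']; ring) (by have := le_max_left (a₁ - e₁) (e₂ - b₂); rw [← hlo] at this; linarith)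
        (by rw [hlo']; linarith [h₁.2, h₂.2, hlo0])
      simpa only [hV] using this
  have hVhi : V hi ≤ Y := by
    rcases min_choice (b₁ - e₁) (e₂ - a₂) with h | h
    · have hhi' : hi = b₁ - e₁ := by rw [hhi, h]
      have := hB hi (by rw [hhi']; ring) (by have := min_le_right (b₁ - e₁) (e₂ - a₂); rw [← hhi] at this; linarith)
        (by rw [hhi']; linarith [h₂.2, hhi0])
      simpa only [hV] using this
    · have hhi' : hi = e₂ - a₂ := by rw [hhi, h]
      have := hC hi (by rw [hhi']; ring) (by rw [hhi']; linarith [h₁.1, hhi0])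
        (by have := min_le_left (b₁ - e₁) (e₂ - a₂); rw [← hhi] at this; linarith)
      simpa only [hV] using this
  have key := quad_le_max_of_convex 0 (T₂ * s₁ - T₁ * s₂ + K * (β₁ * s₁ - β₂ * s₂))
    (T₁ * q₂ + T₂ * q₁ + K * (β₀ + β₁ * q₁ + β₂ * q₂)) lo hi le_rfl hlo0 hhi0
  rw [← hquad lo, ← hquad hi] at key
  exact key.trans (max_le hVlo hVhi)

end TwoBigSeg
end IndepBlob
end Quant
end Summit.CriticalPhenomena.PercolationContinuityZ3.Theorems
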